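import Summits.CriticalPhenomena.PercolationContinuityZ3.Theses.PercExchangeRateTransport

/-!
# Line `birth` — registered skeleton (BC3) for the crux `SupercritExchangeUniformity`
# (stmt-CriticalPhenomena-16061, route `PercExchangeRateTransport`, rank 2, K⁺)

Crux (fixed, by name): `PercExchangeRateTransport.SupercritExchangeUniformity` — K⁺: in the
label-coupled anisotropic bond family on `ℤ² × ℤ` (`x`,`y`-bonds open iff `U_e ≤ p`, `z`-bonds iff
`U_e ≤ t`; `Θ_n(p,t) = P(0 ↔ ∂Λ_n)`, `θ = P(|C(0)| = ∞)`, `p_c(t) = inf{p ∈ [0,1] | θ(p,t) > 0}`),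
for every compact sub-arc `[lo,hi] ⊂ (0,1)` there are `ρ > 0`, `L` and a field `a`, continuous on
the CLOSED supercritical collar `{t ∈ [lo,hi], p_c(t) ≤ p ≤ p_c(t)+ρ}` and `L`-Lipschitz in `p`
there, with `|∂_tΘ_n − a ∂_pΘ_n| ≤ η ∂_pΘ_n` on the collar for all `n ≥ m(η)` (uniform convergence of
the finite-volume EXCHANGE RATE `a_n := ∂_tΘ_n/∂_pΘ_n`, critical window from above included).

THE LINE ("off-window limit + boundary-regular field + window flatness, glued by a three-ε seam";
it is the route's foreseen glued split `K⁺ ⇐ WindowRatioLimit + SupercritOffWindow` of the TWO-LAYER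
PLAN, re-typed with a FIXED-`ε` interface between the two regimes — so that the two regime
statements share no exponent `ν′` and are independent `Prop`s — and with the off-window half cut
once more into its finite-size part and its infinite-volume part):

* `stub_offWindowLimit` (XL; supercritical-phase analysis, technology exists for the isotropic
  diagonal, nothing in print for the family): for every `[lo,hi]` there is `ρ > 0` such that for
  every `ε > 0`, `η > 0` and all `n ≥ m(ε,η)`: `|∂_tΘ_n − a_∞ ∂_pΘ_n| ≤ η ∂_pΘ_n` on
  `{t ∈ [lo,hi], p_c(t)+ε ≤ p ≤ p_c(t)+ρ}`, where `a_∞(p,t) := lim_n a_n(p,t)` is the POINTWISE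
  limit (Mathlib `limUnder`; conjecturally `= ∂_tθ/∂_pθ`). I.e. the exchange rate converges
  uniformly on every part of the collar at fixed positive distance from the curve — the regime
  where `ξ(p,t) < ∞` and `Θ_n → θ` with all derivatives, exponentially fast (Chayes–Chayes–Newman +
  Grimmett–Marstrand finite-cluster decay, Georgakopoulos–Panagiotis analyticity of `θ` on
  `(p_c,1]`, two-parameter Russo / Aizenman–Grimmett).
* `stub_limitFieldRegular` (OPEN — "no fan", infinite-volume version): for every `[lo,hi]` there
  are `ρ > 0`, `L` and a field `a` continuous on the CLOSED `ρ`-collar and `L`-Lipschitz in `p`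
  there which EQUALS `a_∞` at every collar point strictly above the curve. I.e. the limiting
  exchange-rate field of the supercritical phase is uniformly `p`-Lipschitz near the curve and
  extends continuously to it (analytic-scaling-field prediction `a = −p_c′(t) + O(dist)`, `νω > 1`
  on the Bernoulli arc: doi:10.1103/PhysRevB.27.4394, arXiv:1302.0421; Lipschitz critical curves:
  ChayesSchonmann2000 Thm 1.4).
* `stub_windowFlatness` (OPEN, LOAD-BEARING — "no fan", finite-size version; the critical-window
  statement): for every `[lo,hi]` and `η > 0` there are `ε > 0` and `m` with `∂_pΘ_n(p,t) > 0`
  (Russo positivity) and `|a_n(p,t) − a_n(p′,t)| ≤ η` for all `n ≥ m`, `t ∈ [lo,hi]`,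
  `p, p′ ∈ [p_c(t), p_c(t)+ε]`: the finite-volume exchange rate is asymptotically FLAT across the
  window from above (both relevant directions `p`, `t` couple to the one thermal scaling field, so
  `∂_tΘ_n/∂_pΘ_n → c_t/c_p = −p_c′(t)` through the window; 2D ratio-limit prototype
  GarbanPeteSchramm2013Pivotal §4.5, arXiv:1008.1378).
* `SupercritExchangeUniformity_of : Stubs.stub_offWindowLimit → Stubs.stub_limitFieldRegular →
  Stubs.stub_windowFlatness → SupercritExchangeUniformity` (hypotheses the stub `Prop`s BY NAME,
  conclusion the route decl BY NAME; real proof): `ρ := min ρ₁ ρ₂`, continuity/Lipschitz restrict,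
  `a = a_∞` off the curve turns stub 1 into convergence to `a` off every `ε`-window, and the proved
  percolation-free `seam` lemma (three-`ε`: for `p` in the window compare with `p′ = p_c(t)+ε′`,
  `ε′ = min ε ρ (η/(3(|L|+1)))`, via `a_n(p) ≈ a_n(p′) ≈ a(p′) ≈ a(p)`, then multiply back by
  `∂_pΘ_n(p,t) > 0`) gives the inequality on the whole closed collar with the SAME `ρ, L, a`.

HONEST BOOKKEEPING. Modulo the elementary Russo positivity `∂_pΘ_n > 0` (n ≥ 1, open square) the
split is an EQUIVALENCE: K⁺ ⇒ each stub (K⁺ forces `a_n → a` pointwise, so `a = a_∞`; flatness by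
`|a_n(p) − a_n(p′)| ≤ 2η/3 + Lε`), and stubs ⇒ K⁺ is `SupercritExchangeUniformity_of`. No stub is the
crux reworded: stub 1 has no control in the window and no regularity, stub 2 has no convergence,
stub 3 has no limit at all; the regimes are genuinely different mathematics (ξ < ∞ analysis /
boundary behaviour of an infinite-volume field / finite-size scaling in the window). BC3 probes
`stub → SupercritExchangeUniformity` and `stub → _root_.PercolationContinuityZ3` by
`first | exact? | simpa [S] | (unfold S; simpa) | aesop` (maxHeartbeats 400000) FAIL 6/6
(files `bc/*_probe*.lean` of the registering session; for stub 2 → crux the combined chain hit the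
heartbeat cap inside `simpa`, so the four alternatives were re-run separately: 5/5 fail).

DISPROOF USED: none exists for this item (`ledger crux ls stmt-CriticalPhenomena-16061`: no
workfiles, 2026-08-17; no `_false_without_` theorem, no landed `Negative/` lemma). Negatives index
(`ledger negatives --problem CriticalPhenomena`, 11 statements; 3 on this sub: TiltGluing,
CoverIsCovering, QuarantineInequality): none concerns pivotal intensities, exchange rates or
anisotropic critical curves. Dead lines: none recorded for this crux.

Degenerate parameters / junk values: `deriv` of a non-differentiable function is `0` and `x/0 = 0`
— harmless: every `(p,t)` quantified over lies in the open unit square (`t ∈ [lo,hi] ⊂ (0,1)`,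
`p ≥ p_c(t) ≥ (1−hi)/8 > 0` by path counting with monotone vertical runs, `p ≤ p_c(t) + ρ` resp.
`+ ε` with `p_c(t) ≤ p_c(ℤ²) = 1/2`, and the stubs CHOOSE `ρ`, `ε` small), where each `Θ_n` is a
polynomial in `(p,t)` (finitely many uniform labels), so `deriv` is the true partial derivative and
`∂_pΘ_n > 0` for `n ≥ 1` (the straight `x`-path is pivotal with positive probability); stub 3 asserts
this positivity where the seam divides, stubs 1–2 never divide. `limUnder` of a non-convergent
sequence is junk — then stub 1 (which asserts convergence to it off the curve) is false for the
right reason, and in the K⁺ world `a_∞ = a` everywhere on the collar. `n = 0` (`Θ_0 ≡ 1`, all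
derivatives `0`) is excluded by `n ≥ m` (stub 3's positivity forces `m ≥ 1`). `L < 0` is impossible
given `ρ > 0` (two distinct `p, q` in the collar), so `|L|` in the seam costs nothing.
-/

noncomputable section

namespace Summit.CriticalPhenomena.PercolationContinuityZ3.Cruxes.SupercritExchangeUniformity.Birth

open MeasureTheory Filter Topology
open Literature.Probability.Percolation Literature.Probability.LatticeModels
open Summit.CriticalPhenomena.PercolationContinuityZ3.Theses.PercExchangeRateTransport (SupercritExchangeUniformity)

/-! ## Objects of the line (the route's `let`s, named) -/

/-- The vertical (`z`-) bonds of `ℤ³ = ℤ² × ℤ`. -/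
def vertBonds : Set (Sym2 (Site 3)) := {e | ∃ x : Site 3, e = s(x, x + Pi.single (2 : Fin 3) 1)}

/-- The label-coupled anisotropic configuration at levels `(p, t)`: an `x`/`y`-bond `e` is open iff
`U_e ≤ p`, a `z`-bond iff `U_e ≤ t`. -/
def cfgA (p t : ℝ) (U : Sym2 (Site 3) → ℝ) : Set (Sym2 (Site 3)) :=
  {e | e ∈ (zdGraph 3).edgeSet ∧ ((e ∈ vertBonds ∧ U e ≤ t) ∨ (e ∉ vertBonds ∧ U e ≤ p))}

/-- `Θ_n(p,t) = P(0 ↔ ∂Λ_n)` at levels `(p,t)`. -/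
def boxArm (n : ℕ) (p t : ℝ) : ℝ :=
  (labelMeasure (Site 3)).real {U | cfgA p t U ∈ siteToBoundary 3 n}

/-- `θ(p,t) = P(|C(0)| = ∞)` at levels `(p,t)`. -/
def thetaA (p t : ℝ) : ℝ :=
  (labelMeasure (Site 3)).real {U | cfgA p t U ∈ percolatesAt (0 : Site 3)}

/-- The anisotropic critical curve `p_c(t) = inf ({p ∈ [0,1] | θ(p,t) > 0} ∪ {1})`. -/
def pcA (t : ℝ) : ℝ := sInf ({p : ℝ | 0 ≤ p ∧ p ≤ 1 ∧ 0 < thetaA p t} ∪ {1})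

/-- `∂_t Θ_n(p,t)` (pivotal intensity of the `z`-bonds, by Russo). -/
def dT (n : ℕ) (p t : ℝ) : ℝ := deriv (fun s => boxArm n p s) t

/-- `∂_p Θ_n(p,t)` (pivotal intensity of the `x`,`y`-bonds, by Russo). -/
def dP (n : ℕ) (p t : ℝ) : ℝ := deriv (fun q => boxArm n q t) p

/-- The pointwise limit `a_∞(p,t) := lim_n ∂_tΘ_n/∂_pΘ_n` of the finite-volume exchange rate
(Mathlib `limUnder`; the genuine limit wherever the sequence converges, junk elsewhere). -/
def rateLim (p t : ℝ) : ℝ := limUnder atTop (fun n : ℕ => dT n p t / dP n p t)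

/-- The crux, unfolded over the named objects (by `Iff.rfl`). -/
theorem crux_iff : SupercritExchangeUniformity ↔
    ∀ lo hi : ℝ, 0 < lo → lo < hi → hi < 1 → ∃ ρ > (0 : ℝ), ∃ L : ℝ, ∃ a : ℝ → ℝ → ℝ,
      ContinuousOn (fun x : ℝ × ℝ => a x.1 x.2)
          {x : ℝ × ℝ | x.2 ∈ Set.Icc lo hi ∧ pcA x.2 ≤ x.1 ∧ x.1 ≤ pcA x.2 + ρ} ∧
        (∀ t ∈ Set.Icc lo hi, ∀ p q : ℝ, pcA t ≤ p → p ≤ pcA t + ρ → pcA t ≤ q → q ≤ pcA t + ρ →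
          |a p t - a q t| ≤ L * |p - q|) ∧
        ∀ η > (0 : ℝ), ∃ m : ℕ, ∀ n ≥ m, ∀ t ∈ Set.Icc lo hi, ∀ p : ℝ, pcA t ≤ p → p ≤ pcA t + ρ →
          |dT n p t - a p t * dP n p t| ≤ η * dP n p t :=
  Iff.rfl

/-! ## The three registered stubs: precise `Prop`s `Stubs.stub_*` + sorried theorems `stub_*` -/

namespace Stubs

/-- **Stub `Prop` 1 (`OffWindowLimit`)** — locally uniform convergence of the finite-volume
exchange rate OFF the critical window, in the supercritical collar: for every compact sub-arc
`[lo,hi] ⊂ (0,1)` there is `ρ > 0` such that for every `ε > 0` and `η > 0`, for all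
`n ≥ m(ε,η)`, `t ∈ [lo,hi]`, `p ∈ [p_c(t)+ε, p_c(t)+ρ]`:
`|∂_tΘ_n − a_∞ ∂_pΘ_n| ≤ η ∂_pΘ_n`, where `a_∞(p,t) = lim_n ∂_tΘ_n/∂_pΘ_n` is the pointwise limit. -/
def stub_offWindowLimit : Prop :=
  let μ := labelMeasure (Site 3)
  let vert : Sym2 (Site 3) → Prop := fun e => ∃ x : Site 3, e = s(x, x + Pi.single (2 : Fin 3) 1)
  let cfg : ℝ → ℝ → (Sym2 (Site 3) → ℝ) → Set (Sym2 (Site 3)) := fun p t U =>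
    {e | e ∈ (zdGraph 3).edgeSet ∧ ((vert e ∧ U e ≤ t) ∨ (¬ vert e ∧ U e ≤ p))}
  let Θ : ℕ → ℝ → ℝ → ℝ := fun n p t => μ.real {U | cfg p t U ∈ siteToBoundary 3 n}
  let θ : ℝ → ℝ → ℝ := fun p t => μ.real {U | cfg p t U ∈ percolatesAt (0 : Site 3)}
  let pc : ℝ → ℝ := fun t => sInf ({p : ℝ | 0 ≤ p ∧ p ≤ 1 ∧ 0 < θ p t} ∪ {1})
  let aInf : ℝ → ℝ → ℝ := fun p t =>
    limUnder atTop (fun n : ℕ => deriv (fun s => Θ n p s) t / deriv (fun q => Θ n q t) p)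
  ∀ lo hi : ℝ, 0 < lo → lo < hi → hi < 1 → ∃ ρ > (0 : ℝ), ∀ ε > (0 : ℝ), ∀ η > (0 : ℝ), ∃ m : ℕ,
    ∀ n ≥ m, ∀ t ∈ Set.Icc lo hi, ∀ p : ℝ, pc t + ε ≤ p → p ≤ pc t + ρ →
      |deriv (fun s => Θ n p s) t - aInf p t * deriv (fun q => Θ n q t) p| ≤
        η * deriv (fun q => Θ n q t) p

/-- **Stub `Prop` 2 (`LimitFieldRegular`)** — boundary regularity of the limiting exchange-rate
field ("no fan", field version): for every compact sub-arc `[lo,hi] ⊂ (0,1)` there are `ρ > 0`, `L`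
and a field `a`, continuous on the CLOSED collar `{t ∈ [lo,hi], p_c(t) ≤ p ≤ p_c(t)+ρ}` and
`L`-Lipschitz in `p` there, which coincides with the pointwise limit `a_∞ = lim_n ∂_tΘ_n/∂_pΘ_n`
at every point of the collar strictly above the curve. -/
def stub_limitFieldRegular : Prop :=
  let μ := labelMeasure (Site 3)
  let vert : Sym2 (Site 3) → Prop := fun e => ∃ x : Site 3, e = s(x, x + Pi.single (2 : Fin 3) 1)
  let cfg : ℝ → ℝ → (Sym2 (Site 3) → ℝ) → Set (Sym2 (Site 3)) := fun p t U =>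
    {e | e ∈ (zdGraph 3).edgeSet ∧ ((vert e ∧ U e ≤ t) ∨ (¬ vert e ∧ U e ≤ p))}
  let Θ : ℕ → ℝ → ℝ → ℝ := fun n p t => μ.real {U | cfg p t U ∈ siteToBoundary 3 n}
  let θ : ℝ → ℝ → ℝ := fun p t => μ.real {U | cfg p t U ∈ percolatesAt (0 : Site 3)}
  let pc : ℝ → ℝ := fun t => sInf ({p : ℝ | 0 ≤ p ∧ p ≤ 1 ∧ 0 < θ p t} ∪ {1})
  let aInf : ℝ → ℝ → ℝ := fun p t =>
    limUnder atTop (fun n : ℕ => deriv (fun s => Θ n p s) t / deriv (fun q => Θ n q t) p)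
  ∀ lo hi : ℝ, 0 < lo → lo < hi → hi < 1 → ∃ ρ > (0 : ℝ), ∃ L : ℝ, ∃ a : ℝ → ℝ → ℝ,
    ContinuousOn (fun x : ℝ × ℝ => a x.1 x.2)
        {x : ℝ × ℝ | x.2 ∈ Set.Icc lo hi ∧ pc x.2 ≤ x.1 ∧ x.1 ≤ pc x.2 + ρ} ∧
      (∀ t ∈ Set.Icc lo hi, ∀ p q : ℝ, pc t ≤ p → p ≤ pc t + ρ → pc t ≤ q → q ≤ pc t + ρ →
        |a p t - a q t| ≤ L * |p - q|) ∧
      ∀ t ∈ Set.Icc lo hi, ∀ p : ℝ, pc t < p → p ≤ pc t + ρ → a p t = aInf p t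

/-- **Stub `Prop` 3 (`WindowFlatness`)** — asymptotic flatness of the finite-volume exchange rate
across the window FROM ABOVE (the finite-size-scaling statement): for every compact sub-arc
`[lo,hi] ⊂ (0,1)` and every `η > 0` there are `ε > 0` and `m` such that for all `n ≥ m`,
`t ∈ [lo,hi]` and `p, p' ∈ [p_c(t), p_c(t)+ε]`: `∂_pΘ_n(p,t) > 0` (Russo positivity) and
`|a_n(p,t) − a_n(p',t)| ≤ η`, `a_n = ∂_tΘ_n / ∂_pΘ_n`. -/
def stub_windowFlatness : Prop :=
  let μ := labelMeasure (Site 3)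
  let vert : Sym2 (Site 3) → Prop := fun e => ∃ x : Site 3, e = s(x, x + Pi.single (2 : Fin 3) 1)
  let cfg : ℝ → ℝ → (Sym2 (Site 3) → ℝ) → Set (Sym2 (Site 3)) := fun p t U =>
    {e | e ∈ (zdGraph 3).edgeSet ∧ ((vert e ∧ U e ≤ t) ∨ (¬ vert e ∧ U e ≤ p))}
  let Θ : ℕ → ℝ → ℝ → ℝ := fun n p t => μ.real {U | cfg p t U ∈ siteToBoundary 3 n}
  let θ : ℝ → ℝ → ℝ := fun p t => μ.real {U | cfg p t U ∈ percolatesAt (0 : Site 3)}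
  let pc : ℝ → ℝ := fun t => sInf ({p : ℝ | 0 ≤ p ∧ p ≤ 1 ∧ 0 < θ p t} ∪ {1})
  ∀ lo hi : ℝ, 0 < lo → lo < hi → hi < 1 → ∀ η > (0 : ℝ), ∃ ε > (0 : ℝ), ∃ m : ℕ, ∀ n ≥ m,
    ∀ t ∈ Set.Icc lo hi, ∀ p p' : ℝ, pc t ≤ p → p ≤ pc t + ε → pc t ≤ p' → p' ≤ pc t + ε →
      0 < deriv (fun q => Θ n q t) p ∧
        |deriv (fun s => Θ n p s) t / deriv (fun q => Θ n q t) p -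
            deriv (fun s => Θ n p' s) t / deriv (fun q => Θ n q t) p'| ≤ η

end Stubs

/-- Readable form of stub 1 over the named objects (by `Iff.rfl`). -/
theorem stub_offWindowLimit_iff : Stubs.stub_offWindowLimit ↔
    ∀ lo hi : ℝ, 0 < lo → lo < hi → hi < 1 → ∃ ρ > (0 : ℝ), ∀ ε > (0 : ℝ), ∀ η > (0 : ℝ), ∃ m : ℕ,
      ∀ n ≥ m, ∀ t ∈ Set.Icc lo hi, ∀ p : ℝ, pcA t + ε ≤ p → p ≤ pcA t + ρ →
        |dT n p t - rateLim p t * dP n p t| ≤ η * dP n p t :=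
  Iff.rfl

/-- Readable form of stub 2 over the named objects (by `Iff.rfl`). -/
theorem stub_limitFieldRegular_iff : Stubs.stub_limitFieldRegular ↔
    ∀ lo hi : ℝ, 0 < lo → lo < hi → hi < 1 → ∃ ρ > (0 : ℝ), ∃ L : ℝ, ∃ a : ℝ → ℝ → ℝ,
      ContinuousOn (fun x : ℝ × ℝ => a x.1 x.2)
          {x : ℝ × ℝ | x.2 ∈ Set.Icc lo hi ∧ pcA x.2 ≤ x.1 ∧ x.1 ≤ pcA x.2 + ρ} ∧
        (∀ t ∈ Set.Icc lo hi, ∀ p q : ℝ, pcA t ≤ p → p ≤ pcA t + ρ → pcA t ≤ q → q ≤ pcA t + ρ →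
          |a p t - a q t| ≤ L * |p - q|) ∧
        ∀ t ∈ Set.Icc lo hi, ∀ p : ℝ, pcA t < p → p ≤ pcA t + ρ → a p t = rateLim p t :=
  Iff.rfl

/-- Readable form of stub 3 over the named objects (by `Iff.rfl`). -/
theorem stub_windowFlatness_iff : Stubs.stub_windowFlatness ↔
    ∀ lo hi : ℝ, 0 < lo → lo < hi → hi < 1 → ∀ η > (0 : ℝ), ∃ ε > (0 : ℝ), ∃ m : ℕ, ∀ n ≥ m,
      ∀ t ∈ Set.Icc lo hi, ∀ p p' : ℝ, pcA t ≤ p → p ≤ pcA t + ε → pcA t ≤ p' → p' ≤ pcA t + ε →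
        0 < dP n p t ∧ |dT n p t / dP n p t - dT n p' t / dP n p' t| ≤ η :=
  Iff.rfl

/-- **stub 1 (registered) = `Stubs.stub_offWindowLimit` spelled out (XL; supercritical phase).**
Why plausibly true: at fixed positive distance `ε` above the curve the correlation length is finite
uniformly on the compact region, `Θ_n → θ` together with its `p`- and `t`-derivatives (pivotal
expectations; finite-cluster radius decays exponentially for `p > p_c` in `d = 3`,
Chayes–Chayes–Newman + Grimmett–Marstrand; `θ` is analytic on `(p_c,1]`, Georgakopoulos–Panagiotis
arXiv:2001.09178), and `∂_pθ > 0` there (Aizenman–Grimmett), so `a_n → ∂_tθ/∂_pθ = a_∞` uniformly.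
Why it might fail: only as a THEOREM-TO-WRITE — joint `C¹` regularity of `θ(p,t)` and derivative
convergence are not in print for the anisotropic family (isotropic ingredients exist); as typed it
needs `p_c` continuous on `[lo,hi]` for the region to sit compactly inside the supercritical phase
(Aizenman–Grimmett folklore, route item CriticalCurveRegular). -/
theorem stub_offWindowLimit :
    let μ := labelMeasure (Site 3)
    let vert : Sym2 (Site 3) → Prop := fun e => ∃ x : Site 3, e = s(x, x + Pi.single (2 : Fin 3) 1)
    let cfg : ℝ → ℝ → (Sym2 (Site 3) → ℝ) → Set (Sym2 (Site 3)) := fun p t U =>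
      {e | e ∈ (zdGraph 3).edgeSet ∧ ((vert e ∧ U e ≤ t) ∨ (¬ vert e ∧ U e ≤ p))}
    let Θ : ℕ → ℝ → ℝ → ℝ := fun n p t => μ.real {U | cfg p t U ∈ siteToBoundary 3 n}
    let θ : ℝ → ℝ → ℝ := fun p t => μ.real {U | cfg p t U ∈ percolatesAt (0 : Site 3)}
    let pc : ℝ → ℝ := fun t => sInf ({p : ℝ | 0 ≤ p ∧ p ≤ 1 ∧ 0 < θ p t} ∪ {1})
    let aInf : ℝ → ℝ → ℝ := fun p t =>
      limUnder atTop (fun n : ℕ => deriv (fun s => Θ n p s) t / deriv (fun q => Θ n q t) p)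
    ∀ lo hi : ℝ, 0 < lo → lo < hi → hi < 1 → ∃ ρ > (0 : ℝ), ∀ ε > (0 : ℝ), ∀ η > (0 : ℝ), ∃ m : ℕ,
      ∀ n ≥ m, ∀ t ∈ Set.Icc lo hi, ∀ p : ℝ, pc t + ε ≤ p → p ≤ pc t + ρ →
        |deriv (fun s => Θ n p s) t - aInf p t * deriv (fun q => Θ n q t) p| ≤
          η * deriv (fun q => Θ n q t) p := by
  sorry

/-- **stub 2 (registered) = `Stubs.stub_limitFieldRegular` spelled out (OPEN; boundary regularity
of the infinite-volume exchange-rate field).** Why plausibly true: renormalisation-group picture —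
`a_∞(p,t) = ∂_tθ/∂_pθ = −p_c′(t) + O(p − p_c(t))` with analytic nonlinear scaling fields
(Aharony–Fisher, doi:10.1103/PhysRevB.27.4394) and `νω > 1` in 3D (arXiv:1302.0421), hence
uniformly Lipschitz in `p` up to the curve, with boundary value the slope of the `C¹` critical
curve. Why it might fail: it is a statement about the approach to criticality from the
supercritical side with no rigorous tool in `d = 3` (no RSW); a logarithmic modulus
(`νω = 1`-type resonance) would break the Lipschitz clause while keeping continuity — then the
route needs the Osgood variant of its TransportLemma. -/
theorem stub_limitFieldRegular :
    let μ := labelMeasure (Site 3)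
    let vert : Sym2 (Site 3) → Prop := fun e => ∃ x : Site 3, e = s(x, x + Pi.single (2 : Fin 3) 1)
    let cfg : ℝ → ℝ → (Sym2 (Site 3) → ℝ) → Set (Sym2 (Site 3)) := fun p t U =>
      {e | e ∈ (zdGraph 3).edgeSet ∧ ((vert e ∧ U e ≤ t) ∨ (¬ vert e ∧ U e ≤ p))}
    let Θ : ℕ → ℝ → ℝ → ℝ := fun n p t => μ.real {U | cfg p t U ∈ siteToBoundary 3 n}
    let θ : ℝ → ℝ → ℝ := fun p t => μ.real {U | cfg p t U ∈ percolatesAt (0 : Site 3)}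
    let pc : ℝ → ℝ := fun t => sInf ({p : ℝ | 0 ≤ p ∧ p ≤ 1 ∧ 0 < θ p t} ∪ {1})
    let aInf : ℝ → ℝ → ℝ := fun p t =>
      limUnder atTop (fun n : ℕ => deriv (fun s => Θ n p s) t / deriv (fun q => Θ n q t) p)
    ∀ lo hi : ℝ, 0 < lo → lo < hi → hi < 1 → ∃ ρ > (0 : ℝ), ∃ L : ℝ, ∃ a : ℝ → ℝ → ℝ,
      ContinuousOn (fun x : ℝ × ℝ => a x.1 x.2)
          {x : ℝ × ℝ | x.2 ∈ Set.Icc lo hi ∧ pc x.2 ≤ x.1 ∧ x.1 ≤ pc x.2 + ρ} ∧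
        (∀ t ∈ Set.Icc lo hi, ∀ p q : ℝ, pc t ≤ p → p ≤ pc t + ρ → pc t ≤ q → q ≤ pc t + ρ →
          |a p t - a q t| ≤ L * |p - q|) ∧
        ∀ t ∈ Set.Icc lo hi, ∀ p : ℝ, pc t < p → p ≤ pc t + ρ → a p t = aInf p t := by
  sorry

/-- **stub 3 (registered) = `Stubs.stub_windowFlatness` spelled out (OPEN, LOAD-BEARING; the
critical window from above).** Why plausibly true: finite-size scaling — inside the window both
`∂_tΘ_n` and `∂_pΘ_n` are `n^{y_t}` times the derivative of ONE scaling function of the single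
thermal field `u = c_p (p − p_c(t)) + c_t (t − t₀) + …`, so their ratio is `c_t/c_p + O(n^{−ω}) +
O(p − p_c(t))`, flat across `[p_c(t), p_c(t)+ε]` up to `Lε + n^{−ω}`; 2D prototype: ratio limits of
pivotal measures (GarbanPeteSchramm2013Pivotal §4.5, arXiv:1008.1378). Why it might fail: it is a
ratio-limit theorem for two pivotal intensities UNIFORM through the critical window with no
RSW/quasi-multiplicativity in 3D — the item's own named risk, isolated here; in a discontinuous
(jump) world the fan of characteristics sits exactly in this window and the finite-volume rate
varies by `O(1)` across it. Positivity clause: Russo, `n ≥ 1`, open square (elementary). -/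
theorem stub_windowFlatness :
    let μ := labelMeasure (Site 3)
    let vert : Sym2 (Site 3) → Prop := fun e => ∃ x : Site 3, e = s(x, x + Pi.single (2 : Fin 3) 1)
    let cfg : ℝ → ℝ → (Sym2 (Site 3) → ℝ) → Set (Sym2 (Site 3)) := fun p t U =>
      {e | e ∈ (zdGraph 3).edgeSet ∧ ((vert e ∧ U e ≤ t) ∨ (¬ vert e ∧ U e ≤ p))}
    let Θ : ℕ → ℝ → ℝ → ℝ := fun n p t => μ.real {U | cfg p t U ∈ siteToBoundary 3 n}
    let θ : ℝ → ℝ → ℝ := fun p t => μ.real {U | cfg p t U ∈ percolatesAt (0 : Site 3)}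
    let pc : ℝ → ℝ := fun t => sInf ({p : ℝ | 0 ≤ p ∧ p ≤ 1 ∧ 0 < θ p t} ∪ {1})
    ∀ lo hi : ℝ, 0 < lo → lo < hi → hi < 1 → ∀ η > (0 : ℝ), ∃ ε > (0 : ℝ), ∃ m : ℕ, ∀ n ≥ m,
      ∀ t ∈ Set.Icc lo hi, ∀ p p' : ℝ, pc t ≤ p → p ≤ pc t + ε → pc t ≤ p' → p' ≤ pc t + ε →
        0 < deriv (fun q => Θ n q t) p ∧
          |deriv (fun s => Θ n p s) t / deriv (fun q => Θ n q t) p -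
              deriv (fun s => Θ n p' s) t / deriv (fun q => Θ n q t) p'| ≤ η := by
  sorry

/-! ## Proved plumbing: the abstract three-`ε` seam (percolation-free real algebra) -/

/-- **Seam lemma.** For arbitrary "numerator/denominator" families `N D : ℕ → ℝ → ℝ → ℝ` (here
`∂_tΘ_n`, `∂_pΘ_n`) and an arbitrary curve `pc`: a field `a` that is `L`-Lipschitz in `p` on the
closed `ρ`-collar and controls `N − a D` off every `ε`-window (stubs 1+2), together with
asymptotic `η`-flatness of `N/D` across small windows with `D > 0` there (stub 3), controls
`N − a D` on the whole closed collar: for `p` in the window compare with `p' = pc t + ε'`,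
`ε' = min ε ρ (η / (3(|L|+1)))`, through `a_n(p) ≈ a_n(p') ≈ a(p') ≈ a(p)`. -/
theorem seam {N D : ℕ → ℝ → ℝ → ℝ} {pc : ℝ → ℝ} {a : ℝ → ℝ → ℝ} {lo hi ρ L : ℝ} (hρ : 0 < ρ)
    (hlip : ∀ t ∈ Set.Icc lo hi, ∀ p q : ℝ, pc t ≤ p → p ≤ pc t + ρ → pc t ≤ q → q ≤ pc t + ρ →
      |a p t - a q t| ≤ L * |p - q|)
    (hoff : ∀ ε > (0 : ℝ), ∀ η > (0 : ℝ), ∃ m : ℕ, ∀ n ≥ m, ∀ t ∈ Set.Icc lo hi, ∀ p : ℝ,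
      pc t + ε ≤ p → p ≤ pc t + ρ → |N n p t - a p t * D n p t| ≤ η * D n p t)
    (hwin : ∀ η > (0 : ℝ), ∃ ε > (0 : ℝ), ∃ m : ℕ, ∀ n ≥ m, ∀ t ∈ Set.Icc lo hi, ∀ p p' : ℝ,
      pc t ≤ p → p ≤ pc t + ε → pc t ≤ p' → p' ≤ pc t + ε →
        0 < D n p t ∧ |N n p t / D n p t - N n p' t / D n p' t| ≤ η) :
    ∀ η > (0 : ℝ), ∃ m : ℕ, ∀ n ≥ m, ∀ t ∈ Set.Icc lo hi, ∀ p : ℝ, pc t ≤ p → p ≤ pc t + ρ →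
      |N n p t - a p t * D n p t| ≤ η * D n p t := by
  intro η hη
  have hη3 : 0 < η / 3 := by positivity
  -- the window scale of stub 3 at accuracy η/3, shrunk below ρ and below η/(3(|L|+1))
  obtain ⟨ε, hε, m₁, hflat⟩ := hwin (η / 3) hη3
  have hL1 : 0 < |L| + 1 := by positivity
  set ε' : ℝ := min ε (min ρ (η / (3 * (|L| + 1)))) with hε'def
  have hε'pos : 0 < ε' := lt_min hε (lt_min hρ (by positivity))
  have hε'ε : ε' ≤ ε := min_le_left _ _
  have hε'ρ : ε' ≤ ρ := (min_le_right _ _).trans (min_le_left _ _)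
  have hε'L : ε' ≤ η / (3 * (|L| + 1)) := (min_le_right _ _).trans (min_le_right _ _)
  -- stubs 1+2 off the ε'-window, at accuracies η (direct use) and η/3 (comparison point)
  obtain ⟨m₂, hoff₂⟩ := hoff ε' hε'pos η hη
  obtain ⟨m₃, hoff₃⟩ := hoff ε' hε'pos (η / 3) hη3
  refine ⟨max m₁ (max m₂ m₃), fun n hn t ht p hp1 hp2 => ?_⟩
  have hn₁ : m₁ ≤ n := le_trans (le_max_left _ _) hn
  have hn₂ : m₂ ≤ n := le_trans ((le_max_left _ _).trans (le_max_right _ _)) hn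
  have hn₃ : m₃ ≤ n := le_trans ((le_max_right _ _).trans (le_max_right _ _)) hn
  rcases le_or_gt (pc t + ε') p with hcase | hcase
  · -- off the window: stubs 1+2 directly
    exact hoff₂ n hn₂ t ht p hcase hp2
  · -- inside the window: compare with the right end p' = pc t + ε'
    set p' : ℝ := pc t + ε' with hp'def
    have hq1 : pc t ≤ p' := by rw [hp'def]; linarith
    have hq2 : p' ≤ pc t + ε := by rw [hp'def]; linarith
    have hq3 : p' ≤ pc t + ρ := by rw [hp'def]; linarith
    have hpε : p ≤ pc t + ε := by linarith
    obtain ⟨hDp, hdiff⟩ := hflat n hn₁ t ht p p' hp1 hpε hq1 hq2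
    obtain ⟨hDq, -⟩ := hflat n hn₁ t ht p' p' hq1 hq2 hq1 hq2
    -- stubs 1+2 at p', in ratio form
    have h1 := hoff₃ n hn₃ t ht p' (le_of_eq hp'def.symm) hq3
    have hr1 : |N n p' t / D n p' t - a p' t| ≤ η / 3 := by
      have e : N n p' t / D n p' t - a p' t = (N n p' t - a p' t * D n p' t) / D n p' t := by
        field_simp
      rw [e, abs_div, abs_of_pos hDq, div_le_iff₀ hDq]
      exact h1
    -- Lipschitz step from p' back to p
    have hl := hlip t ht p' p hq1 hq3 hp1 (by linarith)
    have hpp' : |p' - p| ≤ ε' := by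
      rw [abs_of_nonneg (by linarith)]
      linarith
    have hl' : |a p' t - a p t| ≤ η / 3 :=
      calc |a p' t - a p t| ≤ L * |p' - p| := hl
        _ ≤ |L| * |p' - p| := mul_le_mul_of_nonneg_right (le_abs_self L) (abs_nonneg _)
        _ ≤ |L| * ε' := mul_le_mul_of_nonneg_left hpp' (abs_nonneg L)
        _ ≤ |L| * (η / (3 * (|L| + 1))) := mul_le_mul_of_nonneg_left hε'L (abs_nonneg L)
        _ ≤ η / 3 := by
          rw [← sub_nonneg]
          have e : η / 3 - |L| * (η / (3 * (|L| + 1))) = (η / 3) * (1 / (|L| + 1)) := by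
            field_simp
            ring
          rw [e]
          positivity
    -- three-ε combination in ratio form, then back to the multiplicative form
    have hsum : |N n p t / D n p t - a p t| ≤ η := by
      calc |N n p t / D n p t - a p t|
          ≤ |N n p t / D n p t - N n p' t / D n p' t| + |N n p' t / D n p' t - a p' t| +
              |a p' t - a p t| := by
            have := abs_sub_le (N n p t / D n p t) (N n p' t / D n p' t) (a p t)
            have := abs_sub_le (N n p' t / D n p' t) (a p' t) (a p t)
            linarith
        _ ≤ η / 3 + η / 3 + η / 3 := by gcongr
        _ = η := by ring
    have e : N n p t - a p t * D n p t = (N n p t / D n p t - a p t) * D n p t := by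
      field_simp
    rw [e, abs_mul, abs_of_pos hDp]
    exact mul_le_mul_of_nonneg_right hsum hDp.le

/-! ## The composition (proved): the three stubs imply the crux BY NAME -/

/-- **`SupercritExchangeUniformity` from the three registered stubs** (hypotheses = the declared
stub `Prop`s by name; conclusion = the route decl
`PercExchangeRateTransport.SupercritExchangeUniformity` by name; no `sorry`): on `[lo,hi]` take
`ρ₁` from stub 1 and `ρ₂, L, a` from stub 2, set `ρ = min ρ₁ ρ₂`; `a` is continuous and
`p`-Lipschitz on the `ρ`-collar (restriction), equals the pointwise limit `a_∞` strictly above the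
curve, so stub 1 gives `|∂_tΘ_n − a ∂_pΘ_n| ≤ η ∂_pΘ_n` off every `ε`-window; the seam lemma fed
with stub 3 (window flatness + positivity) extends this to the whole closed collar. -/
theorem SupercritExchangeUniformity_of (hO : Stubs.stub_offWindowLimit)
    (hR : Stubs.stub_limitFieldRegular) (hW : Stubs.stub_windowFlatness) :
    Summit.CriticalPhenomena.PercolationContinuityZ3.Theses.PercExchangeRateTransport.SupercritExchangeUniformity := by
  refine crux_iff.2 fun lo hi hlo hlh hhi => ?_
  obtain ⟨ρ₁, hρ₁, hconv⟩ := stub_offWindowLimit_iff.1 hO lo hi hlo hlh hhi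
  obtain ⟨ρ₂, hρ₂, L, a, hcont, hlip, hagree⟩ := stub_limitFieldRegular_iff.1 hR lo hi hlo hlh hhi
  have hwin := stub_windowFlatness_iff.1 hW lo hi hlo hlh hhi
  set ρ : ℝ := min ρ₁ ρ₂ with hρdef
  have hρ : 0 < ρ := lt_min hρ₁ hρ₂
  have hρle₁ : ρ ≤ ρ₁ := min_le_left _ _
  have hρle₂ : ρ ≤ ρ₂ := min_le_right _ _
  -- continuity and the Lipschitz clause restrict from the ρ₂-collar to the ρ-collar
  have hcont' : ContinuousOn (fun x : ℝ × ℝ => a x.1 x.2)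
      {x : ℝ × ℝ | x.2 ∈ Set.Icc lo hi ∧ pcA x.2 ≤ x.1 ∧ x.1 ≤ pcA x.2 + ρ} :=
    hcont.mono fun x ⟨hx1, hx2, hx3⟩ => ⟨hx1, hx2, hx3.trans (by linarith)⟩
  have hlip' : ∀ t ∈ Set.Icc lo hi, ∀ p q : ℝ, pcA t ≤ p → p ≤ pcA t + ρ → pcA t ≤ q →
      q ≤ pcA t + ρ → |a p t - a q t| ≤ L * |p - q| :=
    fun t ht p q hp1 hp2 hq1 hq2 => hlip t ht p q hp1 (by linarith) hq1 (by linarith)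
  -- off every ε-window, `a = a_∞` (stub 2) turns stub 1 into convergence to `a`
  have hoff : ∀ ε > (0 : ℝ), ∀ η > (0 : ℝ), ∃ m : ℕ, ∀ n ≥ m, ∀ t ∈ Set.Icc lo hi, ∀ p : ℝ,
      pcA t + ε ≤ p → p ≤ pcA t + ρ → |dT n p t - a p t * dP n p t| ≤ η * dP n p t := by
    intro ε hε η hη
    obtain ⟨m, hm⟩ := hconv ε hε η hη
    refine ⟨m, fun n hn t ht p hp1 hp2 => ?_⟩
    rw [hagree t ht p (by linarith) (by linarith)]
    exact hm n hn t ht p hp1 (by linarith)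
  exact ⟨ρ, hρ, L, a, hcont', hlip', seam hρ hlip' hoff hwin⟩

/-- Wiring check: the registered stubs feed `SupercritExchangeUniformity_of` as stated — the
skeleton IS the crux proof once the three sorries go. -/
example : Summit.CriticalPhenomena.PercolationContinuityZ3.Theses.PercExchangeRateTransport.SupercritExchangeUniformity :=
  SupercritExchangeUniformity_of stub_offWindowLimit stub_limitFieldRegular stub_windowFlatness

end Summit.CriticalPhenomena.PercolationContinuityZ3.Cruxes.SupercritExchangeUniformity.Birth

end
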